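import Summits.Ventures.PercRepro.RankLevelSetLevelSixHeavyCellSq27DI2VX6
import Summits.Ventures.PercRepro.RankLevelSetTriangleUnionConfined
import Summits.Ventures.PercRepro.RankLevelSetConfinedBounds
import Summits.Ventures.PercRepro.RankLevelSetLevelSixT22Cell8Partial
import Summits.Ventures.PercRepro.RankLevelSetLevelSixArithConf_conf7_sq20N8_sh8
import Summits.Ventures.PercRepro.RankLevelSetLevelSixArithConf_conf10_sq20N8_sh8
import Summits.Ventures.PercRepro.RankLevelSetLevelSixArithConf_conf11_sq20N8_sh8
import Summits.Ventures.PercRepro.RankLevelSetLevelSixArithConf_conf13_sq20N8_sh8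

/-!
# PercRepro — THE CORE CELL `(22, 8)` OF THE 22 ROW: THE `s₃ ≥ 7` BRANCHES BY FORM (ii) OF THE CONFINEMENT LEMMA, AND THE
UNCONDITIONAL CELL (p8 g12, S3)

`proofs/P8-G12-LEVER22.md` §7. With `S₃` = the union of the triangles, `ν(S₃) ≥ cq3⁻¹(s₃)` (p3's table on `M ↾ S₃`) and
`|S₃| ≤ 3ν(S₃)` (g11's union lemma), every coindependent `6`-set has `|B ∖ S₃| ≤ 8 − ν(S₃)`, so the coindependent independent
`6`-sets number at most the numeral `X6` of the admissible `(ν, σ)` grid (`RankLevelSetConfinedBounds`) — the cell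
`c025_core_six_heavy_cell_sq27di2v_x6` with that `X6`. The coloop-free cell `(22, 8)`: `s₃ ≤ 2`, `3 … 6` (T22Free8Partial), `7 … 9`,
`10`, `11` (here; the cap `s₃ ≤ 11` is THE TRIANGLE DROP). The every-core terminal `(20, 8)` at shift `8`: `s₃ ≤ 2`, `3 … 6`
(T22Cell8Partial), `7`, `8 … 10`, `11`, `12 … 13` (here; the cap `s₃ ≤ 13` is p3's table). Hence
`c025_core_six_twentytwo_8 : RLS M 22 6` on every `e`-free core of rank `22`, corank `8`. Axioms: standard.
-/

open scoped Matroid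

namespace PercRepro

namespace ThmN

open Set

variable {α : Type}

set_option maxHeartbeats 1600000 in
/-- **The 2-times scaled every-core terminal `(20, 8)`, the branch `s₃ = 7`** (form (ii), `X6 = 280644`). -/
theorem c025_core_six_t22_scaled2_every8_conf7_sq20N8_sh8 (M : Matroid α) [M.Finite]
    (hR : M.eRank = (20 : ℕ∞)) (hn : M.E.ncard = 20 + 8)
    (hfree : ∀ e ∈ M.E, ∃ A ⊆ M.E \ {e}, e ∉ M.closure A ∧ e ∉ M.closure ((M.E \ {e}) \ A))
    (hs3 : {C : Set α | M.IsCircuit C ∧ C.ncard = 3}.ncard ≤ 7)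
    (hlo : 7 ≤ {C : Set α | M.IsCircuit C ∧ C.ncard = 3}.ncard) :
    phiK (20 + 2) 6 / 4 * (Matroid.topCount M 20 6 : ℚ) ≤ (Matroid.midCount M 20 6 : ℚ) := by
  classical
  have hR' : M.eRank = ((20 : ℕ) : ℕ∞) := hR
  have hd : M.E.encard = M.eRank + (8 : ℕ) := by
    rw [hR, ← M.ground_finite.cast_ncard_eq, hn]
    push_cast
    ring
  have hc : ∀ X ⊆ M.E, M.eRk X ≤ ((6 - 2 : ℕ) : ℕ∞) → (X.ncard : ℕ∞) ≤ M.eRk X + cnull 4 :=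
    fun X hX hr => nullity_cap_core M hfree 4 (le_refl 4) X hX (by simpa using hr)
  have hc6 : cnull 4 + 1 ≤ 7 := by simp [cnull]
  have hcj : ∀ X ⊆ M.E, M.eRk X ≤ ((6 - 2 - 1 : ℕ) : ℕ∞) → (X.ncard : ℕ∞) ≤ M.eRk X + cnull (3) :=
    fun X hX hr => nullity_cap_core M hfree 3 (by omega) X hX
      (by rwa [show (6 - 2 - 1 : ℕ) = 3 by omega] at hr)
  have hcj' : ∀ X ⊆ M.E, M.eRk X ≤ ((6 - 1 - 1 - 1 : ℕ) : ℕ∞) → (X.ncard : ℕ∞) ≤ M.eRk X + cnull (3) :=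
    fun X hX hr => nullity_cap_core M hfree 3 (by omega) X hX
      (by rwa [show (6 - 1 - 1 - 1 : ℕ) = 3 by omega] at hr)
  have hUG : (Matroid.UG M 6 7).ncard ≤ 16 := by
    have := Matroid.ncard_UG_le (M := M) (q := 6) (ν₁ := 7) (j := 2) (by norm_num) hd hc hc6 hcj (by norm_num [cnull])
    simpa using this
  have hUH : (Matroid.UH M 6 7).ncard ≤ 14 := by
    have := Matroid.ncard_UH_le (M := M) (q := 6) (ν₁ := 7) (j' := 1) (by norm_num) hd hc hc6 hcj' (by norm_num [cnull])
    simpa using this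
  have hΦ : phiK (20 + 2) 6 / 4 ≤ (2 : ℚ) ^ (20 + 6) / (((20 + 8).choose 6 : ℕ) : ℚ) := by
    have h := phiK_le_two_pow_div_six (20 + 2)
    rw [show 20 + 2 + 6 = 20 + 8 by norm_num] at h
    have h4 : (2 : ℚ) ^ (20 + 8) = 2 ^ (20 + 6) * 4 := by norm_num
    rw [h4] at h
    have h5 := div_le_div_of_nonneg_right h (by norm_num : (0 : ℚ) ≤ 4)
    exact h5.trans (le_of_eq (by ring))
  obtain ⟨ν, σ, hνd, hσ, hσn, hcq, hcount⟩ := exists_triangle_union_bound M hfree hR' hn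
  have hν0 : 5 ≤ ν := by
    by_contra hlt
    have := cq3_lt_seven_of_lt_five ν (by omega)
    omega
  have hX := confined_bound_28_8_5 ν σ hν0 (by omega) hσ (by omega)
  have hX' : ∑ b ∈ Finset.range (8 - ν + 1), (20 + 8 - σ).choose b * σ.choose (6 - b) ≤ 280644 := by
    rw [show (20 : ℕ) + 8 = 28 by norm_num]; exact hX
  have h6 : {B : Set α | B ⊆ M.E ∧ B.ncard = 6 ∧ M.eRk B = 6 ∧ M.eRk (M.E \ B) = M.eRank}.ncard ≤ 280644 := by
    have hsub : {B : Set α | B ⊆ M.E ∧ B.ncard = 6 ∧ M.eRk B = 6 ∧ M.eRk (M.E \ B) = M.eRank} ⊆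
        {B : Set α | B ⊆ M.E ∧ B.ncard = 6 ∧ M.eRk (M.E \ B) = ((20 : ℕ) : ℕ∞)} := by
      rintro B ⟨hBE, hB6, _, hBs⟩
      exact ⟨hBE, hB6, by rw [← hR']; exact hBs⟩
    have hle := Set.ncard_le_ncard hsub (M.ground_finite.finite_subsets.subset (fun B hB => hB.1))
    exact hle.trans (hcount.trans hX')
  exact c025_core_six_heavy_cell_sq27di2v_x6 M 20 8 7 16 14 0 10000 700 14 585 88 7 1716 3432
      ((20 + 8).choose 6) (Nat.choose_pos (by omega)) (phiK (20 + 2) 6 / 4) hΦ (by norm_num) (by omega)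
      (by norm_num) hUG hUH (by omega) (Or.inl (by norm_num)) (by norm_num) (by norm_num) (by norm_num)
      hs3
      ((ncard_fourCircuits_le_avgChain14 8 M hfree hd).trans (by decide))
      ((S1.ncard_fiveCircuits_le_avgChain5c 8 M hfree hd).trans (by decide))
      ((Matroid.ncard_circuits_le_choose_of_encard M hd 5).trans (by decide))
      ((Matroid.ncard_circuits_le_choose_of_encard M hd 6).trans (by decide))
      (Or.inl tail_six_conf7_sq20N8_sh8) hR' hn hfree 280644 h6 level_six_poly_conf7_sq20N8_sh8

set_option maxHeartbeats 1600000 in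
/-- **The 2-times scaled every-core terminal `(20, 8)`, the branch `8 ≤ s₃ ≤ 10`** (form (ii), `X6 = 241944`). -/
theorem c025_core_six_t22_scaled2_every8_conf10_sq20N8_sh8 (M : Matroid α) [M.Finite]
    (hR : M.eRank = (20 : ℕ∞)) (hn : M.E.ncard = 20 + 8)
    (hfree : ∀ e ∈ M.E, ∃ A ⊆ M.E \ {e}, e ∉ M.closure A ∧ e ∉ M.closure ((M.E \ {e}) \ A))
    (hs3 : {C : Set α | M.IsCircuit C ∧ C.ncard = 3}.ncard ≤ 10)
    (hlo : 8 ≤ {C : Set α | M.IsCircuit C ∧ C.ncard = 3}.ncard) :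
    phiK (20 + 2) 6 / 4 * (Matroid.topCount M 20 6 : ℚ) ≤ (Matroid.midCount M 20 6 : ℚ) := by
  classical
  have hR' : M.eRank = ((20 : ℕ) : ℕ∞) := hR
  have hd : M.E.encard = M.eRank + (8 : ℕ) := by
    rw [hR, ← M.ground_finite.cast_ncard_eq, hn]
    push_cast
    ring
  have hc : ∀ X ⊆ M.E, M.eRk X ≤ ((6 - 2 : ℕ) : ℕ∞) → (X.ncard : ℕ∞) ≤ M.eRk X + cnull 4 :=
    fun X hX hr => nullity_cap_core M hfree 4 (le_refl 4) X hX (by simpa using hr)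
  have hc6 : cnull 4 + 1 ≤ 7 := by simp [cnull]
  have hcj : ∀ X ⊆ M.E, M.eRk X ≤ ((6 - 2 - 1 : ℕ) : ℕ∞) → (X.ncard : ℕ∞) ≤ M.eRk X + cnull (3) :=
    fun X hX hr => nullity_cap_core M hfree 3 (by omega) X hX
      (by rwa [show (6 - 2 - 1 : ℕ) = 3 by omega] at hr)
  have hcj' : ∀ X ⊆ M.E, M.eRk X ≤ ((6 - 1 - 1 - 1 : ℕ) : ℕ∞) → (X.ncard : ℕ∞) ≤ M.eRk X + cnull (3) :=
    fun X hX hr => nullity_cap_core M hfree 3 (by omega) X hX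
      (by rwa [show (6 - 1 - 1 - 1 : ℕ) = 3 by omega] at hr)
  have hUG : (Matroid.UG M 6 7).ncard ≤ 16 := by
    have := Matroid.ncard_UG_le (M := M) (q := 6) (ν₁ := 7) (j := 2) (by norm_num) hd hc hc6 hcj (by norm_num [cnull])
    simpa using this
  have hUH : (Matroid.UH M 6 7).ncard ≤ 14 := by
    have := Matroid.ncard_UH_le (M := M) (q := 6) (ν₁ := 7) (j' := 1) (by norm_num) hd hc hc6 hcj' (by norm_num [cnull])
    simpa using this
  have hΦ : phiK (20 + 2) 6 / 4 ≤ (2 : ℚ) ^ (20 + 6) / (((20 + 8).choose 6 : ℕ) : ℚ) := by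
    have h := phiK_le_two_pow_div_six (20 + 2)
    rw [show 20 + 2 + 6 = 20 + 8 by norm_num] at h
    have h4 : (2 : ℚ) ^ (20 + 8) = 2 ^ (20 + 6) * 4 := by norm_num
    rw [h4] at h
    have h5 := div_le_div_of_nonneg_right h (by norm_num : (0 : ℚ) ≤ 4)
    exact h5.trans (le_of_eq (by ring))
  obtain ⟨ν, σ, hνd, hσ, hσn, hcq, hcount⟩ := exists_triangle_union_bound M hfree hR' hn
  have hν0 : 6 ≤ ν := by
    by_contra hlt
    have := cq3_lt_eight_of_lt_six ν (by omega)
    omega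
  have hX := confined_bound_28_8_6 ν σ hν0 (by omega) hσ (by omega)
  have hX' : ∑ b ∈ Finset.range (8 - ν + 1), (20 + 8 - σ).choose b * σ.choose (6 - b) ≤ 241944 := by
    rw [show (20 : ℕ) + 8 = 28 by norm_num]; exact hX
  have h6 : {B : Set α | B ⊆ M.E ∧ B.ncard = 6 ∧ M.eRk B = 6 ∧ M.eRk (M.E \ B) = M.eRank}.ncard ≤ 241944 := by
    have hsub : {B : Set α | B ⊆ M.E ∧ B.ncard = 6 ∧ M.eRk B = 6 ∧ M.eRk (M.E \ B) = M.eRank} ⊆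
        {B : Set α | B ⊆ M.E ∧ B.ncard = 6 ∧ M.eRk (M.E \ B) = ((20 : ℕ) : ℕ∞)} := by
      rintro B ⟨hBE, hB6, _, hBs⟩
      exact ⟨hBE, hB6, by rw [← hR']; exact hBs⟩
    have hle := Set.ncard_le_ncard hsub (M.ground_finite.finite_subsets.subset (fun B hB => hB.1))
    exact hle.trans (hcount.trans hX')
  exact c025_core_six_heavy_cell_sq27di2v_x6 M 20 8 7 16 14 0 10000 620 14 585 88 10 1716 3432
      ((20 + 8).choose 6) (Nat.choose_pos (by omega)) (phiK (20 + 2) 6 / 4) hΦ (by norm_num) (by omega)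
      (by norm_num) hUG hUH (by omega) (Or.inl (by norm_num)) (by norm_num) (by norm_num) (by norm_num)
      hs3
      ((ncard_fourCircuits_le_avgChain14 8 M hfree hd).trans (by decide))
      ((S1.ncard_fiveCircuits_le_avgChain5c 8 M hfree hd).trans (by decide))
      ((Matroid.ncard_circuits_le_choose_of_encard M hd 5).trans (by decide))
      ((Matroid.ncard_circuits_le_choose_of_encard M hd 6).trans (by decide))
      (Or.inl tail_six_conf10_sq20N8_sh8) hR' hn hfree 241944 h6 level_six_poly_conf10_sq20N8_sh8

set_option maxHeartbeats 1600000 in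
/-- **The 2-times scaled every-core terminal `(20, 8)`, the branch `s₃ = 11`** (form (ii), `X6 = 196707`). -/
theorem c025_core_six_t22_scaled2_every8_conf11_sq20N8_sh8 (M : Matroid α) [M.Finite]
    (hR : M.eRank = (20 : ℕ∞)) (hn : M.E.ncard = 20 + 8)
    (hfree : ∀ e ∈ M.E, ∃ A ⊆ M.E \ {e}, e ∉ M.closure A ∧ e ∉ M.closure ((M.E \ {e}) \ A))
    (hs3 : {C : Set α | M.IsCircuit C ∧ C.ncard = 3}.ncard ≤ 11)
    (hlo : 11 ≤ {C : Set α | M.IsCircuit C ∧ C.ncard = 3}.ncard) :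
    phiK (20 + 2) 6 / 4 * (Matroid.topCount M 20 6 : ℚ) ≤ (Matroid.midCount M 20 6 : ℚ) := by
  classical
  have hR' : M.eRank = ((20 : ℕ) : ℕ∞) := hR
  have hd : M.E.encard = M.eRank + (8 : ℕ) := by
    rw [hR, ← M.ground_finite.cast_ncard_eq, hn]
    push_cast
    ring
  have hc : ∀ X ⊆ M.E, M.eRk X ≤ ((6 - 2 : ℕ) : ℕ∞) → (X.ncard : ℕ∞) ≤ M.eRk X + cnull 4 :=
    fun X hX hr => nullity_cap_core M hfree 4 (le_refl 4) X hX (by simpa using hr)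
  have hc6 : cnull 4 + 1 ≤ 7 := by simp [cnull]
  have hcj : ∀ X ⊆ M.E, M.eRk X ≤ ((6 - 2 - 1 : ℕ) : ℕ∞) → (X.ncard : ℕ∞) ≤ M.eRk X + cnull (3) :=
    fun X hX hr => nullity_cap_core M hfree 3 (by omega) X hX
      (by rwa [show (6 - 2 - 1 : ℕ) = 3 by omega] at hr)
  have hcj' : ∀ X ⊆ M.E, M.eRk X ≤ ((6 - 1 - 1 - 1 : ℕ) : ℕ∞) → (X.ncard : ℕ∞) ≤ M.eRk X + cnull (3) :=
    fun X hX hr => nullity_cap_core M hfree 3 (by omega) X hX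
      (by rwa [show (6 - 1 - 1 - 1 : ℕ) = 3 by omega] at hr)
  have hUG : (Matroid.UG M 6 7).ncard ≤ 16 := by
    have := Matroid.ncard_UG_le (M := M) (q := 6) (ν₁ := 7) (j := 2) (by norm_num) hd hc hc6 hcj (by norm_num [cnull])
    simpa using this
  have hUH : (Matroid.UH M 6 7).ncard ≤ 14 := by
    have := Matroid.ncard_UH_le (M := M) (q := 6) (ν₁ := 7) (j' := 1) (by norm_num) hd hc hc6 hcj' (by norm_num [cnull])
    simpa using this
  have hΦ : phiK (20 + 2) 6 / 4 ≤ (2 : ℚ) ^ (20 + 6) / (((20 + 8).choose 6 : ℕ) : ℚ) := by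
    have h := phiK_le_two_pow_div_six (20 + 2)
    rw [show 20 + 2 + 6 = 20 + 8 by norm_num] at h
    have h4 : (2 : ℚ) ^ (20 + 8) = 2 ^ (20 + 6) * 4 := by norm_num
    rw [h4] at h
    have h5 := div_le_div_of_nonneg_right h (by norm_num : (0 : ℚ) ≤ 4)
    exact h5.trans (le_of_eq (by ring))
  obtain ⟨ν, σ, hνd, hσ, hσn, hcq, hcount⟩ := exists_triangle_union_bound M hfree hR' hn
  have hν0 : 7 ≤ ν := by
    by_contra hlt
    have := cq3_lt_eleven_of_lt_seven ν (by omega)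
    omega
  have hX := confined_bound_28_8_7 ν σ hν0 (by omega) hσ (by omega)
  have hX' : ∑ b ∈ Finset.range (8 - ν + 1), (20 + 8 - σ).choose b * σ.choose (6 - b) ≤ 196707 := by
    rw [show (20 : ℕ) + 8 = 28 by norm_num]; exact hX
  have h6 : {B : Set α | B ⊆ M.E ∧ B.ncard = 6 ∧ M.eRk B = 6 ∧ M.eRk (M.E \ B) = M.eRank}.ncard ≤ 196707 := by
    have hsub : {B : Set α | B ⊆ M.E ∧ B.ncard = 6 ∧ M.eRk B = 6 ∧ M.eRk (M.E \ B) = M.eRank} ⊆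
        {B : Set α | B ⊆ M.E ∧ B.ncard = 6 ∧ M.eRk (M.E \ B) = ((20 : ℕ) : ℕ∞)} := by
      rintro B ⟨hBE, hB6, _, hBs⟩
      exact ⟨hBE, hB6, by rw [← hR']; exact hBs⟩
    have hle := Set.ncard_le_ncard hsub (M.ground_finite.finite_subsets.subset (fun B hB => hB.1))
    exact hle.trans (hcount.trans hX')
  exact c025_core_six_heavy_cell_sq27di2v_x6 M 20 8 7 16 14 0 10000 700 14 585 88 11 1716 3432
      ((20 + 8).choose 6) (Nat.choose_pos (by omega)) (phiK (20 + 2) 6 / 4) hΦ (by norm_num) (by omega)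
      (by norm_num) hUG hUH (by omega) (Or.inl (by norm_num)) (by norm_num) (by norm_num) (by norm_num)
      hs3
      ((ncard_fourCircuits_le_avgChain14 8 M hfree hd).trans (by decide))
      ((S1.ncard_fiveCircuits_le_avgChain5c 8 M hfree hd).trans (by decide))
      ((Matroid.ncard_circuits_le_choose_of_encard M hd 5).trans (by decide))
      ((Matroid.ncard_circuits_le_choose_of_encard M hd 6).trans (by decide))
      (Or.inl tail_six_conf11_sq20N8_sh8) hR' hn hfree 196707 h6 level_six_poly_conf11_sq20N8_sh8

set_option maxHeartbeats 1600000 in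
/-- **The 2-times scaled every-core terminal `(20, 8)`, the branch `12 ≤ s₃ ≤ 13`** (form (ii), `X6 = 134596`). -/
theorem c025_core_six_t22_scaled2_every8_conf13_sq20N8_sh8 (M : Matroid α) [M.Finite]
    (hR : M.eRank = (20 : ℕ∞)) (hn : M.E.ncard = 20 + 8)
    (hfree : ∀ e ∈ M.E, ∃ A ⊆ M.E \ {e}, e ∉ M.closure A ∧ e ∉ M.closure ((M.E \ {e}) \ A))
    (hs3 : {C : Set α | M.IsCircuit C ∧ C.ncard = 3}.ncard ≤ 13)
    (hlo : 12 ≤ {C : Set α | M.IsCircuit C ∧ C.ncard = 3}.ncard) :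
    phiK (20 + 2) 6 / 4 * (Matroid.topCount M 20 6 : ℚ) ≤ (Matroid.midCount M 20 6 : ℚ) := by
  classical
  have hR' : M.eRank = ((20 : ℕ) : ℕ∞) := hR
  have hd : M.E.encard = M.eRank + (8 : ℕ) := by
    rw [hR, ← M.ground_finite.cast_ncard_eq, hn]
    push_cast
    ring
  have hc : ∀ X ⊆ M.E, M.eRk X ≤ ((6 - 2 : ℕ) : ℕ∞) → (X.ncard : ℕ∞) ≤ M.eRk X + cnull 4 :=
    fun X hX hr => nullity_cap_core M hfree 4 (le_refl 4) X hX (by simpa using hr)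
  have hc6 : cnull 4 + 1 ≤ 7 := by simp [cnull]
  have hcj : ∀ X ⊆ M.E, M.eRk X ≤ ((6 - 2 - 1 : ℕ) : ℕ∞) → (X.ncard : ℕ∞) ≤ M.eRk X + cnull (3) :=
    fun X hX hr => nullity_cap_core M hfree 3 (by omega) X hX
      (by rwa [show (6 - 2 - 1 : ℕ) = 3 by omega] at hr)
  have hcj' : ∀ X ⊆ M.E, M.eRk X ≤ ((6 - 1 - 1 - 1 : ℕ) : ℕ∞) → (X.ncard : ℕ∞) ≤ M.eRk X + cnull (3) :=
    fun X hX hr => nullity_cap_core M hfree 3 (by omega) X hX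
      (by rwa [show (6 - 1 - 1 - 1 : ℕ) = 3 by omega] at hr)
  have hUG : (Matroid.UG M 6 7).ncard ≤ 16 := by
    have := Matroid.ncard_UG_le (M := M) (q := 6) (ν₁ := 7) (j := 2) (by norm_num) hd hc hc6 hcj (by norm_num [cnull])
    simpa using this
  have hUH : (Matroid.UH M 6 7).ncard ≤ 14 := by
    have := Matroid.ncard_UH_le (M := M) (q := 6) (ν₁ := 7) (j' := 1) (by norm_num) hd hc hc6 hcj' (by norm_num [cnull])
    simpa using this
  have hΦ : phiK (20 + 2) 6 / 4 ≤ (2 : ℚ) ^ (20 + 6) / (((20 + 8).choose 6 : ℕ) : ℚ) := by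
    have h := phiK_le_two_pow_div_six (20 + 2)
    rw [show 20 + 2 + 6 = 20 + 8 by norm_num] at h
    have h4 : (2 : ℚ) ^ (20 + 8) = 2 ^ (20 + 6) * 4 := by norm_num
    rw [h4] at h
    have h5 := div_le_div_of_nonneg_right h (by norm_num : (0 : ℚ) ≤ 4)
    exact h5.trans (le_of_eq (by ring))
  obtain ⟨ν, σ, hνd, hσ, hσn, hcq, hcount⟩ := exists_triangle_union_bound M hfree hR' hn
  have hν0 : 8 ≤ ν := by
    by_contra hlt
    have := cq3_lt_twelve_of_lt_eight ν (by omega)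
    omega
  have hX := confined_bound_28_8_8 ν σ hν0 (by omega) hσ (by omega)
  have hX' : ∑ b ∈ Finset.range (8 - ν + 1), (20 + 8 - σ).choose b * σ.choose (6 - b) ≤ 134596 := by
    rw [show (20 : ℕ) + 8 = 28 by norm_num]; exact hX
  have h6 : {B : Set α | B ⊆ M.E ∧ B.ncard = 6 ∧ M.eRk B = 6 ∧ M.eRk (M.E \ B) = M.eRank}.ncard ≤ 134596 := by
    have hsub : {B : Set α | B ⊆ M.E ∧ B.ncard = 6 ∧ M.eRk B = 6 ∧ M.eRk (M.E \ B) = M.eRank} ⊆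
        {B : Set α | B ⊆ M.E ∧ B.ncard = 6 ∧ M.eRk (M.E \ B) = ((20 : ℕ) : ℕ∞)} := by
      rintro B ⟨hBE, hB6, _, hBs⟩
      exact ⟨hBE, hB6, by rw [← hR']; exact hBs⟩
    have hle := Set.ncard_le_ncard hsub (M.ground_finite.finite_subsets.subset (fun B hB => hB.1))
    exact hle.trans (hcount.trans hX')
  exact c025_core_six_heavy_cell_sq27di2v_x6 M 20 8 7 16 14 0 10000 700 14 585 88 13 1716 3432
      ((20 + 8).choose 6) (Nat.choose_pos (by omega)) (phiK (20 + 2) 6 / 4) hΦ (by norm_num) (by omega)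
      (by norm_num) hUG hUH (by omega) (Or.inl (by norm_num)) (by norm_num) (by norm_num) (by norm_num)
      hs3
      ((ncard_fourCircuits_le_avgChain14 8 M hfree hd).trans (by decide))
      ((S1.ncard_fiveCircuits_le_avgChain5c 8 M hfree hd).trans (by decide))
      ((Matroid.ncard_circuits_le_choose_of_encard M hd 5).trans (by decide))
      ((Matroid.ncard_circuits_le_choose_of_encard M hd 6).trans (by decide))
      (Or.inl tail_six_conf13_sq20N8_sh8) hR' hn hfree 134596 h6 level_six_poly_conf13_sq20N8_sh8


/-- **The 2-times scaled every-core terminal `(20, 8)` with `s₃ ≥ 7`** (the four confinement branches; the cap `s₃ ≤ 13`). -/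
theorem c025_core_six_t22_scaled2_every8_conf (M : Matroid α) [M.Finite]
    (hR : M.eRank = (20 : ℕ∞)) (hn : M.E.ncard = 20 + 8)
    (hfree : ∀ e ∈ M.E, ∃ A ⊆ M.E \ {e}, e ∉ M.closure A ∧ e ∉ M.closure ((M.E \ {e}) \ A))
    (h7 : 7 ≤ {C : Set α | M.IsCircuit C ∧ C.ncard = 3}.ncard) :
    phiK (20 + 2) 6 / 4 * (Matroid.topCount M 20 6 : ℚ) ≤ (Matroid.midCount M 20 6 : ℚ) := by
  have hd : M.E.encard = M.eRank + (8 : ℕ) := by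
    rw [hR, ← M.ground_finite.cast_ncard_eq, hn]
    push_cast
    ring
  have hcap : {C : Set α | M.IsCircuit C ∧ C.ncard = 3}.ncard ≤ 13 :=
    (TriangleCap.core_ncard_triangles_le_cq3 M hfree hd).trans (by decide)
  by_cases h7' : {C : Set α | M.IsCircuit C ∧ C.ncard = 3}.ncard ≤ 7
  · exact c025_core_six_t22_scaled2_every8_conf7_sq20N8_sh8 M hR hn hfree h7' h7
  by_cases h10 : {C : Set α | M.IsCircuit C ∧ C.ncard = 3}.ncard ≤ 10
  · exact c025_core_six_t22_scaled2_every8_conf10_sq20N8_sh8 M hR hn hfree h10 (by omega)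
  by_cases h11 : {C : Set α | M.IsCircuit C ∧ C.ncard = 3}.ncard ≤ 11
  · exact c025_core_six_t22_scaled2_every8_conf11_sq20N8_sh8 M hR hn hfree h11 (by omega)
  · exact c025_core_six_t22_scaled2_every8_conf13_sq20N8_sh8 M hR hn hfree hcap (by omega)

end ThmN

end PercRepro
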